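import Summits.FinalStateConjecture.FinalStateConjecture.Theorems.NearExtremalKappaCapture.Negative.ExponentMonotonicity
import Summits.FinalStateConjecture.FinalStateConjecture.Theorems.BulkKerrCapture.Negative.SpinGapAndMass
import Literature.Geometry.Lorentzian.KerrSurfaceGravity
import Literature.Geometry.Lorentzian.StabilityCauchy
import Literature.Geometry.Lorentzian.ConvergenceTransport
import Literature.Geometry.Lorentzian.IsometricImmersionExp
import Literature.Geometry.Lorentzian.CauchyDevelopmentOneJet

/-!
# Stub F′ (`stub_farCompleteTransport`, rev-2 skeleton) of line `area-excess-ratchet`, crux `NearExtremalKappaCapture`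
# (stmt-FinalStateConjecture-10606): far-completeness is the tree's notion and is inherited by the MGHD

§1 `farComplete_iff_hasCompleteFutureNullInfinityFar` — the line's `FarComplete 𝒟` IS the tree's
`DataEmbedding.HasCompleteFutureNullInfinityFar` (proved, definitional after `range_farSliceIncl`).

§2 `FarComplete.of_embedsInto` — far-completeness is inherited along embeddings of vacuum Cauchy
developments (hence by the MGHD from ANY far-complete vacuum Cauchy development of the data:
`stub_farCompleteTransport`, the registered stub S2 of the lead's rev-2 skeleton). Classical transport (O'Neill 1983, Ch. 3, pp. 90–91; Choquet-Bruhat–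
Geroch 1969, Thm. 3): isometric embeddings carry maximal null geodesics into maximal null geodesics
with larger affine domain, the future unit normal to the future unit normal, and `J⁺` into `J⁺`.

Support file of line `area-excess-ratchet` (law F in its classical, provable form); nothing here
closes the crux. Everything is proved.
-/

noncomputable section

-- single-conjunct summit namespace of the line (lead's convention for this crux's stub files)
set_option linter.dupNamespace false

namespace Summit.FinalStateConjecture.FinalStateConjecture.Theorems.NearExtremalKappaCapture.AreaExcessRatchet

open Literature.Geometry.Lorentzian
open Summit.FinalStateConjecture.FinalStateConjecture.Theorems.NearExtremalKappaCapture.Negative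
open scoped Manifold ContDiff Topology ENNReal
open Set Filter

/-! ## §1 The line's `FarComplete` is the tree's `HasCompleteFutureNullInfinityFar` -/

/-- **`FarComplete 𝒟 ↔ 𝒟.HasCompleteFutureNullInfinityFar`**: the far-origin sojourn clause of the
crux (inlined by the cone repair of 2026-08-15) is verbatim the body of
`DataEmbedding.HasCompleteFutureNullInfinityFar` (`StabilityCauchy.lean`), the origin set
`{q | afRadius a M + 1 ≤ ‖q‖}` being `range (Kerr.farSliceIncl a M)`. Dafermos–Rodnianski,
arXiv:0811.0354, §2.6.2. [folklore] -/
theorem farComplete_iff_hasCompleteFutureNullInfinityFar [Kerr.SliceFacts] {a M : ℝ}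
    {D : InitialDataSet 𝓘(ℝ, E3) (Kerr.slice a M)} (𝒟 : VacuumCauchyDevelopment D) :
    FarComplete 𝒟 ↔ 𝒟.HasCompleteFutureNullInfinityFar := by
  simp only [FarComplete, DataEmbedding.HasCompleteFutureNullInfinityFar,
    DataEmbedding.HasCompleteFutureNullInfinityFrom, BulkKerrCapture.Negative.range_farSliceIncl]


/-! ## §2 Far-completeness is inherited along embeddings of developments -/

section Transport

universe u

variable {n : ℕ} {X : Type u} [TopologicalSpace X] [ChartedSpace (EuclideanSpace ℝ (Fin n)) X]
  [IsManifold (𝓡 n) ∞ X] [ConnectedSpace X] {D : InitialDataSet (𝓡 n) X}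

/-- The Levi-Civita connection of the (smooth) metric of a data embedding is `C¹`, in the form of
the instance consumed by the maximal-geodesic API (Gallot–Hulin–Lafontaine 2004, Prop. 2.54; the
tree's `isLocallyContMDiff_leviCivita_holds`). [folklore] -/
theorem contMDiffCovariantDerivative_leviCivita_dataEmbedding (𝒮 : DataEmbedding D)
    [𝒮.metric.HasLeviCivita] :
    CovariantDerivative.ContMDiffCovariantDerivative 𝒮.metric.leviCivita 1 :=
  ⟨𝒮.metric.toPseudoRiemannianMetric.isLocallyContMDiff_leviCivita_holds 1
    (by rw [show ((1 : ℕ∞) : ℕ∞ω) + 1 = 2 by norm_num]; exact WithTop.coe_le_coe.2 le_top)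
    univ isOpen_univ⟩

/-- **Restricted-origin completeness of `𝓘⁺` is inherited along embeddings of data embeddings.**
If `𝒮₁` embeds into `𝒮₂` (a smooth, time-orientation preserving, isometric open embedding `ψ`
with `ψ ∘ ι₁ = ι₂`) and `𝒮₁` has complete future null infinity as seen from `A`, then so does
`𝒮₂`, with the same compact sets `B₀, B₁`: a normalised null ray `γ` of `𝒮₂` from `p` is, on the
affine domain of the maximal geodesic `γ₁` of `𝒮₁` with initial data `(ι₁ p, dψ⁻¹ γ'(0))`, the
image `ψ ∘ γ₁` (isometric immersions commute with maximal geodesics, O'Neill 1983, Ch. 3,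
pp. 90–91); `γ₁` is again a normalised null ray (`dψ` is a linear isometry mapping the future unit
normal to the future unit normal, `DataEmbedding.mfderiv_normal`, and preserving the time
orientation), so either its domain is unbounded — then so is that of `γ` — or it sojourns `≥ s` in
`J⁺(ι₁ B₀)`, whose image lies in `J⁺(ι₂ B₀)` (`image_causalFuture_subset`). Choquet-Bruhat–Geroch
1969, Thm. 3 (transport of structure along the embedding into the maximal development); O'Neill
1983, Ch. 3, pp. 90–91 and Ch. 14, pp. 402–403. [cite: ONeillSemiRiemannian1983, Ch. 3, pp. 90–91] -/
theorem hasCompleteFutureNullInfinityFrom_of_embedsInto {𝒮₁ 𝒮₂ : DataEmbedding D}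
    (hemb : 𝒮₁.EmbedsInto 𝒮₂) {A : Set X} (h₁ : 𝒮₁.HasCompleteFutureNullInfinityFrom A) :
    𝒮₂.HasCompleteFutureNullInfinityFrom A := by
  intro inst₂
  haveI inst₁ : 𝒮₁.metric.HasLeviCivita :=
    PseudoRiemannianMetric.HasLeviCivita.of _
      PseudoRiemannianMetric.isCovariantDerivativeOn_leviCivitaFun_holds
  haveI := contMDiffCovariantDerivative_leviCivita_dataEmbedding 𝒮₁
  haveI := contMDiffCovariantDerivative_leviCivita_dataEmbedding 𝒮₂
  obtain ⟨ψ, -, -, hψi, hψτ, hψι⟩ := hemb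
  have hψd : MDifferentiable (𝓡 (n + 1)) (𝓡 (n + 1)) ψ := hψi.1.mdifferentiable (by simp)
  have hdim : Module.finrank ℝ (EuclideanSpace ℝ (Fin (n + 1))) =
      Module.finrank ℝ (EuclideanSpace ℝ (Fin (n + 1))) := rfl
  obtain ⟨B₀, hB₀, H⟩ := h₁
  refine ⟨B₀, hB₀, fun s hs ↦ ?_⟩
  obtain ⟨B₁, hB₁, H₁⟩ := H s hs
  refine ⟨B₁, hB₁, fun p hpA hpB γ dom hγ ↦ ?_⟩
  obtain ⟨hmax, h0, hγ0, hnull, hfd, hnorm⟩ := hγ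
  -- the differential of `ψ` at `ι₁ p` is a linear bijection preserving scalar products
  have hx : ψ (𝒮₁.embed p) = 𝒮₂.embed p := congrFun hψι p
  have hγ0' : γ 0 = ψ (𝒮₁.embed p) := by rw [hx, hγ0]
  have key : ∀ u w : TangentSpace (𝓡 (n + 1)) (𝒮₁.embed p),
      𝒮₂.metric.val (ψ (𝒮₁.embed p)) (mfderiv (𝓡 (n + 1)) (𝓡 (n + 1)) ψ (𝒮₁.embed p) u)
        (mfderiv (𝓡 (n + 1)) (𝓡 (n + 1)) ψ (𝒮₁.embed p) w) =
      𝒮₁.metric.val (𝒮₁.embed p) u w := fun u w ↦ by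
    have h := congrArg (fun b ↦ b u w) (hψi.2 (𝒮₁.embed p))
    simpa only [pullbackBilin_apply] using h
  have hLinj : Function.Injective (mfderiv (𝓡 (n + 1)) (𝓡 (n + 1)) ψ (𝒮₁.embed p)) :=
    hψi.injective_mfderiv (𝒮₁.embed p)
  haveI : FiniteDimensional ℝ (TangentSpace (𝓡 (n + 1)) (𝒮₁.embed p)) :=
    inferInstanceAs (FiniteDimensional ℝ (EuclideanSpace ℝ (Fin (n + 1))))
  have hLsurj : Function.Surjective (mfderiv (𝓡 (n + 1)) (𝓡 (n + 1)) ψ (𝒮₁.embed p)) :=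
    (LinearMap.injective_iff_surjective
      (f := ((mfderiv (𝓡 (n + 1)) (𝓡 (n + 1)) ψ (𝒮₁.embed p)).toLinearMap :
        EuclideanSpace ℝ (Fin (n + 1)) →ₗ[ℝ] EuclideanSpace ℝ (Fin (n + 1))))).1 hLinj
  -- transport the initial velocity of `γ` back to `𝒮₁`
  obtain ⟨v₁, hv₁⟩ := hLsurj (velocity (𝓡 (n + 1)) γ 0)
  -- the maximal geodesic `γ₁` of `𝒮₁` with these initial data, and its image under `ψ`
  obtain ⟨γ₁, dom₁, hmax₁, h0₁, hγ₁0, hvel₁⟩ : ∃ (γ₁ : ℝ → 𝒮₁.carrier) (dom₁ : Set ℝ),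
      IsMaximalGeodesicOn 𝒮₁.metric.leviCivita γ₁ dom₁ ∧ (0 : ℝ) ∈ dom₁ ∧
        γ₁ 0 = 𝒮₁.embed p ∧ velocity (𝓡 (n + 1)) γ₁ 0 = v₁ :=
    ⟨_, _, Literature.Geometry.Riemannian.maximalGeodesic_spec' (cov := 𝒮₁.metric.leviCivita)
      (𝒮₁.embed p) v₁⟩
  obtain ⟨hgeo₁, hvelc⟩ := hψi.isGeodesicOn_comp hdim hmax₁.isOpen hmax₁.isGeodesicOn
  have hc0 : (ψ ∘ γ₁) 0 = γ 0 := by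
    rw [Function.comp_apply, hγ₁0, hγ0']
  have hcv : velocity (𝓡 (n + 1)) (ψ ∘ γ₁) 0 = velocity (𝓡 (n + 1)) γ 0 := by
    rw [hvelc 0 h0₁, hvel₁, hγ₁0, hv₁]
  obtain ⟨hsub₁, heq₁⟩ :=
    Literature.Geometry.Riemannian.subset_maximalGeodesicDomain_of_isGeodesicOn hmax₁.isOpen
      hmax₁.2.1 h0₁ hgeo₁ hc0 hcv
  obtain ⟨hdomeq, hγeq⟩ :=
    Literature.Geometry.Riemannian.maximalGeodesic_unique (cov := 𝒮₂.metric.leviCivita) hmax h0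
      rfl rfl
  have hdom₁d : dom₁ ⊆ dom := by
    rw [hdomeq]
    exact hsub₁
  have hψγ : ∀ t ∈ dom₁, ψ (γ₁ t) = γ t := fun t ht ↦ by
    rw [show ψ (γ₁ t) = (ψ ∘ γ₁) t from rfl, heq₁ ht, ← hγeq (hdom₁d ht)]
  -- `γ₁` is a normalised null ray of `𝒮₁` from `p`
  have hnull₁ : 𝒮₁.metric.IsNull v₁ := by
    refine ⟨?_, fun hv ↦ hnull.2 ?_⟩
    · rw [← key, hv₁, ← hγ0']
      exact hnull.1
    · rw [← hv₁, hv]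
      exact map_zero _
  have hfdL : 𝒮₂.timeOrientation.IsFutureDirected
      (mfderiv (𝓡 (n + 1)) (𝓡 (n + 1)) ψ (𝒮₁.embed p) v₁) := by
    rw [hv₁, ← hγ0']
    exact hfd
  have hfd₁ : 𝒮₁.timeOrientation.IsFutureDirected v₁ := by
    rcases 𝒮₁.timeOrientation.isFutureDirected_or_isPastDirected_of_isCausal hnull₁.isCausal
      with h | h
    · exact h
    · exfalso
      have hneg : 𝒮₁.timeOrientation.IsFutureDirected (-v₁) :=
        (𝒮₁.timeOrientation.isFutureDirected_neg_iff v₁).2 h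
      have himg := hψτ.isFutureDirected_mfderiv hψi.2 hneg
      rw [map_neg, TimeOrientation.isFutureDirected_neg_iff] at himg
      exact 𝒮₂.timeOrientation.not_isPastDirected_of_isFutureDirected hfdL himg
  have hnorm₁ : 𝒮₁.metric.val (𝒮₁.embed p) v₁ (𝒮₁.normal p) = -1 := by
    rw [← key, hv₁, DataEmbedding.mfderiv_normal 𝒮₁ 𝒮₂ hψi hψτ hψι p, hx]
    exact hnorm
  have hray₁ : 𝒮₁.metric.IsNormalisedNullRayFrom 𝒮₁.timeOrientation 𝒮₁.embed 𝒮₁.normal p γ₁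
      dom₁ := by
    refine ⟨hmax₁, h0₁, hγ₁0, ?_, ?_, ?_⟩
    · rw [hvel₁, hγ₁0]; exact hnull₁
    · rw [hvel₁, hγ₁0]; exact hfd₁
    · rw [hvel₁]; exact hnorm₁
  -- far-completeness of `𝒮₁` at the ray `γ₁`, transported
  rcases H₁ p hpA hpB γ₁ dom₁ hray₁ with hunb | hsoj
  · exact Or.inl fun hb ↦ hunb (hb.mono hdom₁d)
  · refine Or.inr (hsoj.trans ?_)
    unfold sojournTime
    refine MeasureTheory.measure_mono fun t ht ↦ ?_
    obtain ⟨htd, ht0, htJ⟩ := ht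
    refine ⟨hdom₁d htd, ht0, ?_⟩
    have himg := LorentzianMetric.image_causalFuture_subset hψd hψτ hψi.2 (𝒮₁.embed '' B₀)
      ⟨γ₁ t, htJ, hψγ t htd⟩
    have hBB : ψ '' (𝒮₁.embed '' B₀) = 𝒮₂.embed '' B₀ := by
      rw [Set.image_image]
      exact Set.image_congr fun x _ ↦ congrFun hψι x
    rw [hBB] at himg
    exact himg

/-- **The MGHD inherits far-completeness from any far-complete vacuum Cauchy development of the
data** (`FarComplete` form, data on `Kerr.slice a M`): by maximality the far-complete development
embeds into `𝒟`, and far-completeness is inherited along the embedding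
(`hasCompleteFutureNullInfinityFrom_of_embedsInto`). This is how the printed stability theorems
pass from their bootstrap spacetime (Klainerman–Szeftel 2023, Def. 3.4.4–3.4.5, "admissible future
null complete development `𝓜_∞`") to the MGHD. Choquet-Bruhat–Geroch 1969, Thm. 3.
[cite: ChoquetBruhatGeroch1969CMP, Thm. 3 (p. 332)] -/
theorem stub_farCompleteTransport [Kerr.SliceFacts] {a M : ℝ}
    {D : InitialDataSet 𝓘(ℝ, E3) (Kerr.slice a M)} {𝒟 : VacuumCauchyDevelopment D}
    (h𝒟 : 𝒟.IsMaximal) (𝒟' : VacuumCauchyDevelopment D) (h' : FarComplete 𝒟') :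
    FarComplete 𝒟 := by
  rw [farComplete_iff_hasCompleteFutureNullInfinityFar] at h' ⊢
  exact hasCompleteFutureNullInfinityFrom_of_embedsInto (h𝒟 𝒟') h'

end Transport


end Summit.FinalStateConjecture.FinalStateConjecture.Theorems.NearExtremalKappaCapture.AreaExcessRatchet

end
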